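import Summits.NavierStokesRegularity.NavierStokesRegularity.Theses.RellichScar
import Summits.NavierStokesRegularity.NavierStokesRegularity.Theorems.SymmetricScarExists.Negative.SpiralWorld
import Summits.NavierStokesRegularity.NavierStokesRegularity.Theorems.RellichScarSimilarityCovariance
import Summits.NavierStokesRegularity.NavierStokesRegularity.Theorems.RellichScarSymmetricScarExistsSplit
import Literature.Analysis.FluidPDE.SelfSimilar

/-!
# Crux `SymmetricScarExists` (stmt-NavierStokesRegularity-11718), line rdss-screw-split, child B:
# ORBIT-ONLY CONSUMPTION of `ScarRigidity` and the kinematics of the screw action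

Line rdss-screw-split decomposes the crux `S = SymmetricScarExists` of route RellichScar into
`A` = RDSS scar selection, `B` = RDSS scar rigidity (`stub_rdssScarRigidity`: a singular apex Type-I
profile whose scar is fixed by a screw-dilation `g = (c, θ)`, `c > 1`, is a.e. fixed by `g` on the slab),
`C` = RDSS apex Fatal; the glue `symmetricScarExists_of_rdssSplit` and `rdssScarRigidity_of_scarRigidity`
are landed (`Theorems/RellichScarSymmetricScarExistsSplit.lean`).  Child `B` is the decisive, XL-open step
of the sibling crux `ScarRigidity` (stmt-NavierStokesRegularity-11717) and is NOT closed here.  This file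
lands its provable by-products:

* **ORBIT-SR** (written inline each time; no definition): scar rigidity for every ORBIT-INTERNAL pair
  `(g·u, u)`, `g = (c, θ) ∈ ℝ₊ × SO(2)` acting by the screw `g·u = R_θ D_c u =
  fun t x => rotZ θ (nsRescale c u t (rotZ (-θ) x))` (definitionally `conjZ θ (nsRescale c u)`);
  `(c, θ) = (λ, 0)` is the dilation pair, `(1, θ)` the rotation pair, `1 < c` child `B`.
* `closes_of_orbitScarRigidity` — the route's deciding theorem `RellichScar.closes` with its first
  hypothesis `ScarRigidity` replaced by ORBIT-SR, kernel-checked: **the whole route consumes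
  `ScarRigidity` only for orbit-internal pairs**, and then `SimilarityCovariance` becomes idle.
* `orbitScarRigidity_of_scarRigidity` — calibration `ScarRigidity → ORBIT-SR` (covariance from the
  landed `similarityCovariance_proof`).
* `stub_rdssScarRigidity_of_orbitScarRigidity` — `ORBIT-SR → B` (restriction to `1 < c`).
* ORBIT TOOLKIT (first page of any attack on `B`): `screw_screw` (group law of the screw action),
  `screw_iterate`, `hasTypeIDecay_conjZ`, `hasTypeIDecay_screw` (the Type-I apex bound is
  screw-invariant), `screw_sub` (the action is linear), `birkhoff_telescope` (Birkhoff sums of the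
  zero-scar difference `g·v − v` along the `ℤ`-orbit telescope to `gᴺ·v − v`) and `norm_birkhoff_le`
  (so they stay Type-I bounded by `2C/(‖x‖ + √−t)`, uniformly in `N`).

References: G. Koch, N. Nadirashvili, G. Seregin, V. Šverák, Acta Math. 203 (2009) §1 (1.5)–(1.6)
[KNSS2009]; Z. Bradshaw, T.-P. Tsai, Comm. PDE 42 (2017), §5 OP 5.1 [BradshawTsai2017CPDE];
B. Pineau, V. Vicol, arXiv:2607.09619, Conj. 1.1, Remark 1.5 [PineauVicol2026].
-/

noncomputable section

open MeasureTheory Set Function Filter Topology TopologicalSpace Metric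
open scoped NNReal ENNReal

namespace Summit.NavierStokesRegularity.NavierStokesRegularity.Theorems.SymmetricScarExists.RdssSplit.Orbit

open Literature.Analysis.FluidPDE
open Summit.NavierStokesRegularity.NavierStokesRegularity.Theses.RellichScar
open Summit.NavierStokesRegularity.NavierStokesRegularity.Theorems.SymmetricScarExists.Negative
open Summit.NavierStokesRegularity.NavierStokesRegularity.Theorems.SymmetricScarExists.RdssSplit

set_option linter.dupNamespace false

/-! ### B1. The route closes from orbit-internal scar rigidity -/

/-- **Orbit-only consumption of `ScarRigidity` by route RellichScar.**  This is the route's deciding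
theorem `RellichScar.closes` with its first hypothesis `ScarRigidity` (two arbitrary singular apex
profiles with the same scar coincide) replaced by ORBIT-SR: scar rigidity for the orbit-internal pairs
`(R_θ D_c u, u)`, `0 < c`, `θ ∈ ℝ`, stated with the class data of `u` alone.  The proof is the body of
`closes`: in the homogeneous branch ORBIT-SR is used at the dilation pair `(c, θ) = (λ, 0)` (the untwisted
screw is `nsRescale λ`, `rdss_zero_twist_eq`), in the axisymmetric branch at the rotation pair `(1, θ)`
(`nsRescale_one`).  IDLE HYPOTHESES (kept because they are part of the statement, underscored in the
proof): `SimilarityCovariance` — ORBIT-SR needs no class membership of `g·u`, so covariance is not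
consumed at all; every other hypothesis is used exactly as in `closes`. [folklore] -/
theorem closes_of_orbitScarRigidity :
    (∀ (u : ℝ → EuclideanSpace ℝ (Fin 3) → EuclideanSpace ℝ (Fin 3)) (p : ℝ → EuclideanSpace ℝ (Fin 3) → ℝ) (G : ℝ → EuclideanSpace ℝ (Fin 3) → EuclideanSpace ℝ (Fin 3) →L[ℝ] EuclideanSpace ℝ (Fin 3)) (C c θ : ℝ), IsSuitableWeakSolutionOn (slab (EuclideanSpace ℝ (Fin 3)) (Iio 0) isOpen_Iio) 1 0 u p → HasWeakSpatialGradientOn (slab (EuclideanSpace ℝ (Fin 3)) (Iio 0) isOpen_Iio) u G → typeIBound (Iio (0 : ℝ) ×ˢ univ) u p G < ⊤ → HasTypeIDecay C u → IsBackwardSingularPoint u 0 → 0 < c → (∀ K : Set (EuclideanSpace ℝ (Fin 3)), IsCompact K → (0 : EuclideanSpace ℝ (Fin 3)) ∉ K → Tendsto (fun δ : ℝ => eLpNorm (uncurry (fun t x => rotZ θ (nsRescale c u t (rotZ (-θ) x))) - uncurry u) ⊤ (volume.restrict (Ioo (-δ) 0 ×ˢ K))) (nhdsWithin 0 (Ioi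 0)) (nhds 0)) → uncurry (fun t x => rotZ θ (nsRescale c u t (rotZ (-θ) x))) =ᵐ[volume.restrict (Iio (0 : ℝ) ×ˢ univ)] uncurry u) → SymmetricScarExists → ApexLocalisation → NoTypeII → SimilarityCovariance → SelfSimilarApexFatal → AxisymmetricApexFatal → TypeIBlowupProfile → ClayFromNoBlowup → _root_.NavierStokesRegularity := by
  intro hOrb hZ hLoc hII _hCov hSS hAx hP hClay
  apply hClay
  intro ν T hν hT u p hcl hLH hdec
  by_contra hext
  -- a classical Leray–Hopf solution with no smooth extension past T is maximal; NoTypeII gives the Type-I rate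
  have hI : IsTypeIBlowup u T := hII ν T hν hT u p ⟨hcl, hext⟩ hLH hdec
  -- Type-I-rate blow-up ⇒ a local-energy profile with the Type-I RATE, singular at the origin
  obtain ⟨w, q, H, C, hsw, hgr, hIb, hdecay, hsing⟩ := hP ν T hν hT u p ⟨hcl, hext⟩ hLH hdec hI
  -- localisation ⇒ a profile with the SPACE–TIME Type-I bound at the apex, singular at the origin
  obtain ⟨C', v, q', H', hsw', hgr', hIb', hdec', hsing'⟩ :=
    hLoc C ⟨w, q, H, hsw, hgr, hIb, hdecay, hsing⟩
  -- the crux: some such profile has a (−1)-homogeneous or an axisymmetric scar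
  obtain ⟨C'', z, pz, Gz, hsz, hgz, hIz, hdz, hsingz, hsym⟩ :=
    hZ C' ⟨v, q', H', hsw', hgr', hIb', hdec', hsing'⟩
  rcases hsym with hhom | hax
  · -- homogeneous scar: ORBIT-SR at the dilation pairs (λ, 0) makes z a.e. self-similar — Tsai forbids
    refine hSS z pz Gz C'' hsz hgz hIz hdz hsingz ?_
    intro lam hlam
    have key := hOrb z pz Gz C'' lam 0 hsz hgz hIz hdz hsingz hlam
    rw [rdss_zero_twist_eq] at key
    exact key (hhom lam hlam)
  · -- axisymmetric scar: ORBIT-SR at the rotation pairs (1, θ) makes z a.e. axisymmetric — Seregin–Šverák forbids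
    refine hAx z pz Gz C'' hsz hgz hIz hdz hsingz ?_
    intro θ
    have key := hOrb z pz Gz C'' 1 θ hsz hgz hIz hdz hsingz one_pos
    rw [nsRescale_one] at key
    exact key (hax θ)

/-! ### B2. Calibration: `ScarRigidity → ORBIT-SR` -/

/-- **ORBIT-SR is weaker than `ScarRigidity`**: the screw-dilated profile `R_θ D_c u` (`0 < c`) lies in
the apex class with the same constant and is singular at the origin (two uses of the landed
`similarityCovariance_proof`, item stmt-NavierStokesRegularity-11720), so `ScarRigidity` applied to the
pair `(R_θ D_c u, u)` is ORBIT-SR.  Same proof as `rdssScarRigidity_of_scarRigidity_of_cov` (there for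
`1 < c`). [folklore] -/
theorem orbitScarRigidity_of_scarRigidity :
    ScarRigidity → (∀ (u : ℝ → EuclideanSpace ℝ (Fin 3) → EuclideanSpace ℝ (Fin 3)) (p : ℝ → EuclideanSpace ℝ (Fin 3) → ℝ) (G : ℝ → EuclideanSpace ℝ (Fin 3) → EuclideanSpace ℝ (Fin 3) →L[ℝ] EuclideanSpace ℝ (Fin 3)) (C c θ : ℝ), IsSuitableWeakSolutionOn (slab (EuclideanSpace ℝ (Fin 3)) (Iio 0) isOpen_Iio) 1 0 u p → HasWeakSpatialGradientOn (slab (EuclideanSpace ℝ (Fin 3)) (Iio 0) isOpen_Iio) u G → typeIBound (Iio (0 : ℝ) ×ˢ univ) u p G < ⊤ → HasTypeIDecay C u → IsBackwardSingularPoint u 0 → 0 < c → (∀ K : Set (EuclideanSpace ℝ (Fin 3)), IsCompact K → (0 : EuclideanSpace ℝ (Fin 3)) ∉ K → Tendsto (fun δ : ℝ => eLpNorm (uncurry (fun t x => rotZ θ (nsRescale c u t (rotZ (-θ) x))) - uncurry u) ⊤ (volume.restrict (Ioo (-δ) 0 ×ˢ K))) (nhdsWithin 0 (Ioi 0)) (nhds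 0)) → uncurry (fun t x => rotZ θ (nsRescale c u t (rotZ (-θ) x))) =ᵐ[volume.restrict (Iio (0 : ℝ) ×ˢ univ)] uncurry u) := by
  intro hSR u p G C c θ hsw hwg hI hdec hsing hc hscar
  obtain ⟨q₁, H₁, hs₁, hg₁, hI₁, hd₁, hsing₁⟩ :=
    (Summit.NavierStokesRegularity.NavierStokesRegularity.Theorems.RellichScarSimilarityCovariance.similarityCovariance_proof
      u p G C hsw hwg hI hdec hsing).1 c hc
  obtain ⟨q₂, H₂, hs₂, hg₂, hI₂, hd₂, hsing₂⟩ :=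
    (Summit.NavierStokesRegularity.NavierStokesRegularity.Theorems.RellichScarSimilarityCovariance.similarityCovariance_proof
      (nsRescale c u) q₁ H₁ C hs₁ hg₁ hI₁ hd₁ hsing₁).2 θ
  exact hSR _ q₂ H₂ u p G C hs₂ hg₂ hI₂ hd₂ hsw hwg hI hdec hsing₂ hsing hscar

/-! ### B3. `ORBIT-SR → B` -/

/-- **ORBIT-SR implies child B** (`stub_rdssScarRigidity`, the case `1 < c`): restriction of the orbit
parameter from `0 < c` to `1 < c`. [folklore] -/
theorem stub_rdssScarRigidity_of_orbitScarRigidity :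
    (∀ (u : ℝ → EuclideanSpace ℝ (Fin 3) → EuclideanSpace ℝ (Fin 3)) (p : ℝ → EuclideanSpace ℝ (Fin 3) → ℝ) (G : ℝ → EuclideanSpace ℝ (Fin 3) → EuclideanSpace ℝ (Fin 3) →L[ℝ] EuclideanSpace ℝ (Fin 3)) (C c θ : ℝ), IsSuitableWeakSolutionOn (slab (EuclideanSpace ℝ (Fin 3)) (Iio 0) isOpen_Iio) 1 0 u p → HasWeakSpatialGradientOn (slab (EuclideanSpace ℝ (Fin 3)) (Iio 0) isOpen_Iio) u G → typeIBound (Iio (0 : ℝ) ×ˢ univ) u p G < ⊤ → HasTypeIDecay C u → IsBackwardSingularPoint u 0 → 0 < c → (∀ K : Set (EuclideanSpace ℝ (Fin 3)), IsCompact K → (0 : EuclideanSpace ℝ (Fin 3)) ∉ K → Tendsto (fun δ : ℝ => eLpNorm (uncurry (fun t x => rotZ θ (nsRescale c u t (rotZ (-θ) x))) - uncurry u) ⊤ (volume.restrict (Ioo (-δ) 0 ×ˢ K))) (nhdsWithin 0 (Ioi 0)) (nhds 0)) → uncurry (fun t x => rotZ θ (nsRescale c u t (rotZ (-θ) x)))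 =ᵐ[volume.restrict (Iio (0 : ℝ) ×ˢ univ)] uncurry u) → ∀ (u : ℝ → EuclideanSpace ℝ (Fin 3) → EuclideanSpace ℝ (Fin 3)) (p : ℝ → EuclideanSpace ℝ (Fin 3) → ℝ) (G : ℝ → EuclideanSpace ℝ (Fin 3) → EuclideanSpace ℝ (Fin 3) →L[ℝ] EuclideanSpace ℝ (Fin 3)) (C c θ : ℝ), IsSuitableWeakSolutionOn (slab (EuclideanSpace ℝ (Fin 3)) (Iio 0) isOpen_Iio) 1 0 u p → HasWeakSpatialGradientOn (slab (EuclideanSpace ℝ (Fin 3)) (Iio 0) isOpen_Iio) u G → typeIBound (Iio (0 : ℝ) ×ˢ univ) u p G < ⊤ → HasTypeIDecay C u → IsBackwardSingularPoint u 0 → 1 < c → (∀ K : Set (EuclideanSpace ℝ (Fin 3)), IsCompact K → (0 : EuclideanSpace ℝ (Fin 3)) ∉ K → Tendsto (fun δ : ℝ => eLpNorm (uncurry (fun t x => rotZ θ (nsRescale c u t (rotZ (-θ) x))) - uncurry u) ⊤ (volume.restrict (Ioo (-δ) 0 ×ˢ K))) (nhdsWithin 0 (Ioi 0)) (nhds 0))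 → uncurry (fun t x => rotZ θ (nsRescale c u t (rotZ (-θ) x))) =ᵐ[volume.restrict (Iio (0 : ℝ) ×ˢ univ)] uncurry u := by
  intro hOrb u p G C c θ hsw hwg hI hdec hsing hc hscar
  exact hOrb u p G C c θ hsw hwg hI hdec hsing (one_pos.trans hc) hscar

/-! ### B4. Orbit toolkit: kinematics of the screw action `g·v = conjZ θ (nsRescale c v)` -/

/-- **Group law of the screw action**: `(c, θ)·((c', θ')·v) = (c c', θ + θ')·v` — rotations about
`e₃` commute with parabolic dilations (`nsRescale_conjZ`), compose additively (`conjZ_conjZ`), and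
dilations compose multiplicatively (`nsRescale_mul`). [folklore] -/
theorem screw_screw :
    ∀ (θ θ' c c' : ℝ) (v : ℝ → EuclideanSpace ℝ (Fin 3) → EuclideanSpace ℝ (Fin 3)), conjZ θ (nsRescale c (conjZ θ' (nsRescale c' v))) = conjZ (θ + θ') (nsRescale (c * c') v) := by
  intro θ θ' c c' v
  rw [nsRescale_conjZ, conjZ_conjZ, mul_comm c c', nsRescale_mul]

/-- **Iterates of one screw**: `((c, θ)·)^[n] v = (cⁿ, n θ)·v`. [folklore] -/
theorem screw_iterate :
    ∀ (θ c : ℝ) (v : ℝ → EuclideanSpace ℝ (Fin 3) → EuclideanSpace ℝ (Fin 3)) (n : ℕ), (fun w : ℝ → EuclideanSpace ℝ (Fin 3) → EuclideanSpace ℝ (Fin 3) => conjZ θ (nsRescale c w))^[n] v = conjZ ((n : ℝ) * θ) (nsRescale (c ^ n) v) := by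
  intro θ c v n
  induction n with
  | zero => simp [conjZ_zero, nsRescale_one]
  | succ n ih =>
    rw [Function.iterate_succ_apply', ih, screw_screw, pow_succ']
    congr 1
    push_cast
    ring

/-- The space–time Type-I bound `‖v t x‖ ≤ C/(‖x‖ + √−t)` is invariant under rotation-conjugation
about `e₃` (`‖R_θ y‖ = ‖y‖`, `norm_rotZ`). [cite: KNSS2009, §1 (1.5)–(1.6)] -/
theorem hasTypeIDecay_conjZ :
    ∀ (C θ : ℝ) (v : ℝ → EuclideanSpace ℝ (Fin 3) → EuclideanSpace ℝ (Fin 3)), HasTypeIDecay C v → HasTypeIDecay C (conjZ θ v) := by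
  intro C θ v hv t ht x
  have key := hv t ht (rotZ (-θ) x)
  rw [norm_rotZ] at key
  simpa only [conjZ, norm_rotZ] using key

/-- **The Type-I apex bound is screw-invariant**: `HasTypeIDecay C v → HasTypeIDecay C ((c, θ)·v)` for
`0 < c` (scale invariance `HasTypeIDecay.nsRescale` + rotation invariance `hasTypeIDecay_conjZ`).
[cite: KNSS2009, §1 (1.6)] -/
theorem hasTypeIDecay_screw :
    ∀ (C c θ : ℝ) (v : ℝ → EuclideanSpace ℝ (Fin 3) → EuclideanSpace ℝ (Fin 3)), 0 < c → HasTypeIDecay C v → HasTypeIDecay C (conjZ θ (nsRescale c v)) := by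
  intro C c θ v hc hv
  exact hasTypeIDecay_conjZ C θ _ (hv.nsRescale hc)

/-- `R_θ` is additive: `R_θ (a − b) = R_θ a − R_θ b`. [folklore] -/
theorem rotZ_map_sub :
    ∀ (θ : ℝ) (a b : EuclideanSpace ℝ (Fin 3)), rotZ θ (a - b) = rotZ θ a - rotZ θ b := by
  intro θ a b
  ext i
  fin_cases i <;> simp <;> ring

/-- **The screw action is linear**: `(c, θ)·(f − g) = (c, θ)·f − (c, θ)·g` pointwise. [folklore] -/
theorem screw_sub :
    ∀ (θ c : ℝ) (f g : ℝ → EuclideanSpace ℝ (Fin 3) → EuclideanSpace ℝ (Fin 3)) (t : ℝ) (x : EuclideanSpace ℝ (Fin 3)), conjZ θ (nsRescale c (fun s y => f s y - g s y)) t x = conjZ θ (nsRescale c f) t x - conjZ θ (nsRescale c g) t x := by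
  intro θ c f g t x
  simp only [conjZ, nsRescale_apply, smul_sub, rotZ_map_sub]

/-- **Birkhoff sums of the zero-scar difference telescope.**  With `g = (c, θ)` and `w = g·v − v`,
`∑_{n<N} gⁿ·w = gᴺ·v − v` pointwise (linearity of the action, `screw_sub`, and the group law
`screw_screw`). [folklore] -/
theorem birkhoff_telescope :
    ∀ (θ c : ℝ) (v : ℝ → EuclideanSpace ℝ (Fin 3) → EuclideanSpace ℝ (Fin 3)) (N : ℕ) (t : ℝ) (x : EuclideanSpace ℝ (Fin 3)), (Finset.range N).sum (fun n => (conjZ ((n : ℝ) * θ) (nsRescale (c ^ n) (fun s y => conjZ θ (nsRescale c v) s y - v s y))) t x) = conjZ ((N : ℝ) * θ) (nsRescale (c ^ N) v) t x - v t x := by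
  intro θ c v N t x
  have key : ∀ n : ℕ, conjZ ((n : ℝ) * θ) (nsRescale (c ^ n) (fun s y => conjZ θ (nsRescale c v) s y - v s y)) t x = conjZ (((n + 1 : ℕ) : ℝ) * θ) (nsRescale (c ^ (n + 1)) v) t x - conjZ ((n : ℝ) * θ) (nsRescale (c ^ n) v) t x := by
    intro n
    rw [screw_sub, screw_screw, pow_succ, show ((n + 1 : ℕ) : ℝ) * θ = (n : ℝ) * θ + θ by push_cast; ring]
  simp_rw [key]
  rw [Finset.sum_range_sub (fun n : ℕ => conjZ ((n : ℝ) * θ) (nsRescale (c ^ n) v) t x) N]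
  simp [conjZ_zero, nsRescale_one]

/-- **Birkhoff sums of the zero-scar difference stay Type-I bounded, uniformly in `N`**: for `0 < c`
and `‖v‖ ≤ C/(‖x‖ + √−t)`, `‖gᴺ·v − v‖ ≤ 2C/(‖x‖ + √−t)` on `t < 0` (triangle inequality and
`hasTypeIDecay_screw` at `(cᴺ, N θ)`). [folklore] -/
theorem norm_birkhoff_le :
    ∀ (C c θ : ℝ) (v : ℝ → EuclideanSpace ℝ (Fin 3) → EuclideanSpace ℝ (Fin 3)), 0 < c → HasTypeIDecay C v → ∀ (N : ℕ) (t : ℝ), t < 0 → ∀ x : EuclideanSpace ℝ (Fin 3), ‖conjZ ((N : ℝ) * θ) (nsRescale (c ^ N) v) t x - v t x‖ ≤ 2 * C / (‖x‖ + Real.sqrt (-t)) := by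
  intro C c θ v hc hv N t ht x
  have h1 := hasTypeIDecay_screw C (c ^ N) ((N : ℝ) * θ) v (pow_pos hc N) hv t ht x
  have h2 := hv t ht x
  calc ‖conjZ ((N : ℝ) * θ) (nsRescale (c ^ N) v) t x - v t x‖
      ≤ ‖conjZ ((N : ℝ) * θ) (nsRescale (c ^ N) v) t x‖ + ‖v t x‖ := norm_sub_le _ _
    _ ≤ C / (‖x‖ + Real.sqrt (-t)) + C / (‖x‖ + Real.sqrt (-t)) := add_le_add h1 h2
    _ = 2 * C / (‖x‖ + Real.sqrt (-t)) := by ring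

end Summit.NavierStokesRegularity.NavierStokesRegularity.Theorems.SymmetricScarExists.RdssSplit.Orbit

end
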